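import Mathlib
import Summits.Ventures.PercRepro2.HubBernstein
import Summits.Ventures.PercRepro2.HCovCubic
import Summits.Ventures.PercRepro2.TriDisagreementPinned
import Summits.Ventures.PercRepro2.BernUnique

/-!
# The cubic form as a tensor-Bernstein form whose coefficients are the full-profile typed counts
(blind cell PercRepro2, mine-2 g22; the first file of the per-profile (typed) pendant dictionary)

`Gc p = triSum p ∅ τ K3 = Σ_{x,y,z} P(x) P(y) P(z) K3 x y z` (`hcov_cubic`), and the product of the three
weights is the degree-3 Bernstein basis function of the profile `prof x y z` (`Hub.weight_mul_mul`), so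

  **`Gc_eq_bern_full`**: `Gc p = Σ_k bern p k · fullCount K3 k`,  `fullCount K k = Σ_{prof x y z = k} K x y z`

— and `fullCount K k = typedCount univ z (k as ℕ) K` (`fullCount_eq_typedCount`): the full-profile typed count
(every edge typed; pinned edges are the types `0` / `3`).  `typedCount_eq_fullCount` converts a pinned typed
count `typedCount F z τ K` into the full-profile count at `(τ on F, 3·z off F)`.
`PMTypedPendant.lean` applies the uniqueness of Bernstein coefficients (`BernUnique.lean`) to the pendant
dictionary (Theorem 13) and reads off the typed (PM).
-/

namespace Summit.Ventures.PercRepro2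

open CovForm Hub

namespace PMTyped

section Full

variable {E : Type*} [Fintype E] [DecidableEq E] {R : Type*} [CommRing R]

/-- The full-profile count of a kernel: the sum of `K` over the triples of profile `k`. -/
noncomputable def fullCount (K : Config E → Config E → Config E → R) (k : E → Fin 4) : R :=
  ∑ t : Config E × Config E × Config E with prof t.1 t.2.1 t.2.2 = k, K t.1 t.2.1 t.2.2

omit [Fintype E] [DecidableEq E] in
/-- A profile equals `k` iff every open count is `k`. -/
lemma prof_eq_iff (x y w : Config E) (k : E → Fin 4) :
    prof x y w = k ↔ ∀ e, openCount x y w e = (k e : ℕ) := by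
  constructor
  · intro h e; rw [← h]; rfl
  · intro h; funext e; exact Fin.ext (h e)

/-- The full-profile count is the typed count with every edge typed. -/
lemma fullCount_eq_typedCount (K : Config E → Config E → Config E → R) (z : Config E)
    (k : E → Fin 4) :
    fullCount K k = typedCount Finset.univ z (fun e => (k e : ℕ)) K := by
  unfold fullCount typedCount
  rw [Finset.sum_filter]
  simp only [Fintype.sum_prod_type, Finset.mem_univ, not_true_eq_false, IsEmpty.forall_iff,
    implies_true, true_and, forall_true_left]
  refine Finset.sum_congr rfl fun x _ => Finset.sum_congr rfl fun y _ => Finset.sum_congr rfl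
    fun w _ => ?_
  simp only [prof_eq_iff]

/-- **The cubic form in the degree-3 Bernstein basis**, coefficients the full-profile counts. -/
theorem triSum_empty_eq_bern (p : E → R) (τ : E → ℕ) (K : Config E → Config E → Config E → R) :
    triSum p ∅ τ K = ∑ k, bern p k * fullCount K k := by
  rw [triSum_empty]
  have e : ∑ x : Config E, ∑ y : Config E, ∑ z : Config E,
      weight p x * weight p y * weight p z * K x y z =
      ∑ t : Config E × Config E × Config E,
        weight p t.1 * weight p t.2.1 * weight p t.2.2 * K t.1 t.2.1 t.2.2 := by
    simp only [Fintype.sum_prod_type]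
  rw [e, ← Finset.sum_fiberwise Finset.univ
    (fun t : Config E × Config E × Config E => prof t.1 t.2.1 t.2.2)]
  refine Finset.sum_congr rfl fun k _ => ?_
  unfold fullCount
  rw [Finset.mul_sum]
  refine Finset.sum_congr rfl fun t ht => ?_
  rw [Finset.mem_filter] at ht
  rw [← ht.2, weight_mul_mul]

/-- The full profile of a pinned typed count: the types on `F`, `3` / `0` off `F` according to the pinning. -/
def fullProfile (F : Finset E) (z : Config E) (τ : E → ℕ) (hτ : ∀ e ∈ F, τ e ≤ 3) : E → Fin 4 :=
  fun e => if h : e ∈ F then ⟨τ e, by have := hτ e h; omega⟩ else (if z e then 3 else 0)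

omit [Fintype E] [DecidableEq E] in
/-- Off `F`, agreeing with the pinning is the open count `3` (pinned open) or `0` (pinned closed). -/
lemma agree_iff_openCount (x y w : Config E) (z : Config E) (e : E) :
    (x e = z e ∧ y e = z e ∧ w e = z e) ↔
      openCount x y w e = ((if z e then (3 : Fin 4) else 0) : Fin 4) := by
  unfold openCount
  cases z e <;> cases x e <;> cases y e <;> cases w e <;> simp

/-- **A pinned typed count is a full-profile count** at `(τ on F, 3·z off F)`. -/
theorem typedCount_eq_fullCount (F : Finset E) (z : Config E) (τ : E → ℕ) (hτ : ∀ e ∈ F, τ e ≤ 3)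
    (K : Config E → Config E → Config E → R) :
    typedCount F z τ K = fullCount K (fullProfile F z τ hτ) := by
  unfold fullCount typedCount
  rw [Finset.sum_filter]
  simp only [Fintype.sum_prod_type]
  refine Finset.sum_congr rfl fun x _ => Finset.sum_congr rfl fun y _ => Finset.sum_congr rfl
    fun w _ => ?_
  have key : ((∀ e, e ∉ F → x e = z e ∧ y e = z e ∧ w e = z e) ∧ (∀ e ∈ F, openCount x y w e = τ e)) ↔
      prof x y w = fullProfile F z τ hτ := by
    rw [prof_eq_iff]
    constructor
    · rintro ⟨h1, h2⟩ e
      unfold fullProfile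
      by_cases he : e ∈ F
      · rw [dif_pos he]; exact h2 e he
      · rw [dif_neg he]; exact (agree_iff_openCount x y w z e).1 (h1 e he)
    · intro h
      refine ⟨fun e he => ?_, fun e he => ?_⟩
      · have := h e; unfold fullProfile at this; rw [dif_neg he] at this
        exact (agree_iff_openCount x y w z e).2 this
      · have := h e; unfold fullProfile at this; rw [dif_pos he] at this; exact this
  simp only [key]


end Full

end PMTyped

end Summit.Ventures.PercRepro2
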